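import Literature.MathematicalPhysics.QuantumFieldTheory.Balaban1983to89.BlockAveragingSU2
import HarnessLib

/-!
# S2β · seam (b) — THE QUATERNIONIC PART OF A `2 × 2` COMPLEX MATRIX AND ITS `SU(2)` NORMALISATION (site algebra for near-stabiliser rigidity)

Cell `ym3-torus` (YM ladder rung R3 = continuum `SU(2)` Yang–Mills on the three-torus at fixed lattice data — a RUNG: NOT d = 4, NOT infinite volume,
NOT a mass gap, NOT Clay).  Width seat `ym3-torus-px8` (gen 19), the (T)-chain of LINE g18-1 S2β, seam (b).  Crux `stmt-QuantumFields-20520`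
(`…Theses.UnitScaleTilt.FluctuationComparisonRegPrIntL`); `--kind proof --supports stmt-QuantumFields-20520 --as helper`, count-neutral, DEFINITION-FREE
(0 `def`, 0 `instance`, 0 `notation`, default heartbeats).

WHAT.  The site-level `2 × 2` algebra behind NEAR-STABILISER RIGIDITY AT EVERY DATUM (consumer: `…S2BetaNearStabiliserRigidity`, this seat's next file — the
reducible-stratum edition of ✓px21 (T7a) `…S2BetaNearSymmetryRigidity`):
* the quaternionic involution `c ↦ (adj c)†` of `M₂(ℂ)` — MULTIPLICATIVE (`star_adjugate_mul`), FIXES `SU(2)` (`star_adjugate_coe`, lit ✓`star_coe_eq_adjugate`); `adj` is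
  linear and involutive in dimension two (lit ✓`adjugate_fin_two_eq_trace_smul_sub`);
* the quaternions `{q | q† = adj q}`: `q†q = det q·1`, `det q ∈ ℝ_{≥0}`, `det q = 0 ⇒ q = 0`, `‖q‖² = Re det q` (C*-identity), and `projMat q ∈ SU(2)` (`projMat_mem_of_quat`,
  generalising lit ✓`SU2Mean.projMat_qsum_mem` from sums of `SU(2)` matrices to all quaternions — same proof); the QUATERNIONIC PART `½(c + (adj c)†)` of any `c` is a
  quaternion (`star_half_add_eq_adjugate`) with `‖½(d + (adj d)†)‖ ≤ 2‖d‖` (entry bound lit ✓`SolovayKitaev.norm_apply_le_norm`);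
* ★ THE SITE ESTIMATE `norm_coe_sub_projMat_le`: for `s ∈ SU(2)` and ANY `c ∈ M₂(ℂ)`, `‖s − projMat (½(c + (adj c)†))‖ ≤ 4·‖s − c‖` — a matrix near a special unitary one
  has its normalised quaternionic part at most four times as far.

HONEST: [folklore] matrix algebra; nothing of Bałaban's analysis; seam (b), POS∘, ISOL∘(δ), TUBE-REG∘, GAP♯∘, EXW∘, S2β, crux 20520 NOT proved; no summit statement is proved by
a helper; rung R3 = SU(2) YM₃ on T³ — NOT d = 4, NOT infinite volume, NOT a mass gap, NOT Clay; the Yang–Mills mass gap is NOT proved.  Sorry-free, axioms standard.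

References: T. Bałaban, CMP **98** (1985) 17–51 [Balaban1985Averaging] ((8) p.19, (19) p.21 — the `SU(2)` letters `dist1`, gauge action); CMP **109** (1987) 249–301
[Balaban1987RG1] ((0.5)–(0.7) p.253 — the quaternionic projected mean `projMat`).
-/

set_option autoImplicit false

noncomputable section

namespace Summit.QuantumFields.YangMills.Theorems.FluctuationComparisonRegPrIntLS2BetaQuaternionicPart

open scoped Matrix.Norms.L2Operator ComplexOrder
open Literature.MathematicalPhysics.QuantumFieldTheory.Balaban1983to89
open Literature.Computability.QuantumComplexity (adjugate_fin_two_eq_trace_smul_sub star_coe_eq_adjugate)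
open Literature.MathematicalPhysics.QuantumFieldTheory.Balaban1983to89.SU2Mean (projMat projMat_of_ne projMat_of_eq projMat_mul_mul)

/-! ## §1 The quaternionic involution `c ↦ (adj c)†` of `M₂(ℂ)` and the quaternions `{q | q† = adj q}` -/


/-- `(adj (A B))† = (adj A)† (adj B)†`: the involution `c ↦ (adj c)†` is MULTIPLICATIVE. [folklore] -/
theorem star_adjugate_mul (A B : Matrix (Fin 2) (Fin 2) ℂ) :
    star (Matrix.adjugate (A * B)) = star (Matrix.adjugate A) * star (Matrix.adjugate B) := by
  rw [Matrix.adjugate_mul_distrib, star_mul]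

/-- `(adj u)† = u` for `u ∈ SU(2)` (`u† = adj u`): the involution FIXES `SU(2)`. [folklore] -/
theorem star_adjugate_coe (u : Matrix.specialUnitaryGroup (Fin 2) ℂ) :
    star (Matrix.adjugate (u : Matrix (Fin 2) (Fin 2) ℂ)) = (u : Matrix (Fin 2) (Fin 2) ℂ) := by
  rw [← star_coe_eq_adjugate, star_star]

/-- `adj` is ADDITIVE on `2 × 2` matrices (`adj M = tr M · 1 − M`). [folklore] -/
theorem adjugate_add_two (A B : Matrix (Fin 2) (Fin 2) ℂ) :
    Matrix.adjugate (A + B) = Matrix.adjugate A + Matrix.adjugate B := by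
  rw [adjugate_fin_two_eq_trace_smul_sub, adjugate_fin_two_eq_trace_smul_sub, adjugate_fin_two_eq_trace_smul_sub,
    Matrix.trace_add, add_smul]
  abel

/-- `adj (r • M) = r • adj M` on `2 × 2` matrices. [folklore] -/
theorem adjugate_smul_two (r : ℂ) (A : Matrix (Fin 2) (Fin 2) ℂ) :
    Matrix.adjugate (r • A) = r • Matrix.adjugate A := by
  rw [Matrix.adjugate_smul, Fintype.card_fin]
  norm_num

/-- `adj (adj M) = M` on `2 × 2` matrices. [folklore] -/
theorem adjugate_adjugate_two (A : Matrix (Fin 2) (Fin 2) ℂ) : Matrix.adjugate (Matrix.adjugate A) = A := by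
  rw [Matrix.adjugate_adjugate A (by rw [Fintype.card_fin]; norm_num), Fintype.card_fin]
  norm_num

/-- `adj (M†) = (adj M)†`. [folklore] -/
theorem adjugate_star (A : Matrix (Fin 2) (Fin 2) ℂ) : Matrix.adjugate (star A) = star (Matrix.adjugate A) := by
  rw [Matrix.star_eq_conjTranspose, Matrix.star_eq_conjTranspose, Matrix.adjugate_conjTranspose]

/-- **THE QUATERNIONIC PART** `½(c + (adj c)†)` of any `c ∈ M₂(ℂ)` is a quaternion: `q† = adj q`. [folklore] -/
theorem star_half_add_eq_adjugate (c : Matrix (Fin 2) (Fin 2) ℂ) :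
    star ((2⁻¹ : ℂ) • (c + star (Matrix.adjugate c))) = Matrix.adjugate ((2⁻¹ : ℂ) • (c + star (Matrix.adjugate c))) := by
  have h2 : star (2⁻¹ : ℂ) = 2⁻¹ := by
    rw [Complex.star_def, map_inv₀, map_ofNat]
  rw [star_smul, h2, star_add, star_star, adjugate_smul_two, adjugate_add_two, adjugate_star, adjugate_adjugate_two, add_comm]

/-- For a quaternion `q` (`q† = adj q`): `q† q = det q · 1`. [folklore] -/
theorem star_mul_self_of_quat {q : Matrix (Fin 2) (Fin 2) ℂ} (hq : star q = Matrix.adjugate q) :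
    star q * q = q.det • (1 : Matrix (Fin 2) (Fin 2) ℂ) := by
  rw [hq, Matrix.adjugate_mul]

/-- For a quaternion `q`: `q q† = det q · 1`. [folklore] -/
theorem self_mul_star_of_quat {q : Matrix (Fin 2) (Fin 2) ℂ} (hq : star q = Matrix.adjugate q) :
    q * star q = q.det • (1 : Matrix (Fin 2) (Fin 2) ℂ) := by
  rw [hq, Matrix.mul_adjugate]

/-- For a quaternion `q`: `det q` is real, `conj (det q) = det q`. [folklore] -/
theorem star_det_of_quat {q : Matrix (Fin 2) (Fin 2) ℂ} (hq : star q = Matrix.adjugate q) : star q.det = q.det := by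
  have h := congrArg Matrix.det hq
  rw [Matrix.star_eq_conjTranspose, Matrix.det_conjTranspose, Matrix.det_adjugate] at h
  simpa using h

/-- For a quaternion `q`: `det q = Re det q` as a complex number. [folklore] -/
theorem det_eq_ofReal_of_quat {q : Matrix (Fin 2) (Fin 2) ℂ} (hq : star q = Matrix.adjugate q) : q.det = ((q.det.re : ℝ) : ℂ) := by
  have him : q.det.im = 0 := by
    have h := congrArg Complex.im (star_det_of_quat hq)
    rw [Complex.star_def, Complex.conj_im] at h
    linarith
  apply Complex.ext <;> simp [him]

/-- For a quaternion `q`: `Re det q ≥ 0` (it is `|q₀₀|² + |q₁₀|²`). [folklore] -/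
theorem det_re_nonneg_of_quat {q : Matrix (Fin 2) (Fin 2) ℂ} (hq : star q = Matrix.adjugate q) : 0 ≤ q.det.re := by
  have h := congrFun (congrFun (star_mul_self_of_quat hq) 0) 0
  rw [Matrix.mul_apply, Matrix.smul_apply, Matrix.one_apply_eq, smul_eq_mul, mul_one] at h
  rw [← h, Complex.re_sum]
  refine Finset.sum_nonneg fun j _ => ?_
  rw [Matrix.star_apply, Complex.star_def, mul_comm, Complex.mul_conj, Complex.ofReal_re]
  exact Complex.normSq_nonneg _

/-- For a quaternion `q`: `det q = 0 ⇒ q = 0`. [folklore] -/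
theorem eq_zero_of_quat_of_det_eq_zero {q : Matrix (Fin 2) (Fin 2) ℂ} (hq : star q = Matrix.adjugate q) (h : q.det = 0) : q = 0 := by
  have h1 := star_mul_self_of_quat hq
  rw [h, zero_smul, Matrix.star_eq_conjTranspose] at h1
  exact Matrix.conjTranspose_mul_self_eq_zero.1 h1

/-- For a quaternion `q`: `‖q‖² = Re det q` (C*-identity `‖q† q‖ = ‖q‖²` and `q† q = det q · 1`). [folklore] -/
theorem norm_sq_eq_det_re_of_quat {q : Matrix (Fin 2) (Fin 2) ℂ} (hq : star q = Matrix.adjugate q) : ‖q‖ ^ 2 = q.det.re := by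
  have hcs : ‖star q * q‖ = ‖q‖ * ‖q‖ := CStarRing.norm_star_mul_self
  rw [sq, ← hcs, star_mul_self_of_quat hq, norm_smul, CStarRing.norm_one, mul_one, det_eq_ofReal_of_quat hq, Complex.norm_real,
    Real.norm_eq_abs, Complex.ofReal_re, abs_of_nonneg (det_re_nonneg_of_quat hq)]

/-- For a quaternion `q`: `‖q‖ = √(Re det q)`. [folklore] -/
theorem norm_eq_sqrt_det_re_of_quat {q : Matrix (Fin 2) (Fin 2) ℂ} (hq : star q = Matrix.adjugate q) : ‖q‖ = Real.sqrt q.det.re := by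
  rw [← norm_sq_eq_det_re_of_quat hq, Real.sqrt_sq (norm_nonneg _)]

/-- **NORMALISED NON-ZERO QUATERNIONS ARE SPECIAL UNITARY**: for a quaternion `q`, lit ✓`SU2Mean.projMat q` (`= (√Re det q)⁻¹ • q`, or `1` if `det q = 0`) lies in `SU(2)` — the
generalisation of lit ✓`SU2Mean.projMat_qsum_mem` from sums of `SU(2)` matrices to all quaternions (same proof). [folklore] -/
theorem projMat_mem_of_quat {q : Matrix (Fin 2) (Fin 2) ℂ} (hq : star q = Matrix.adjugate q) :
    projMat q ∈ Matrix.specialUnitaryGroup (Fin 2) ℂ := by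
  by_cases h : q.det = 0
  · rw [projMat_of_eq h]; exact one_mem _
  · have hpos : 0 < q.det.re := by
      rcases (det_re_nonneg_of_quat hq).lt_or_eq with hlt | heq
      · exact hlt
      · exact absurd (by rw [det_eq_ofReal_of_quat hq, ← heq, Complex.ofReal_zero]) h
    set c : ℝ := (Real.sqrt q.det.re)⁻¹ with hc
    have hcc : (c : ℂ) * (c : ℂ) * q.det = 1 := by
      rw [det_eq_ofReal_of_quat hq, ← Complex.ofReal_mul, ← Complex.ofReal_mul, ← Complex.ofReal_one, Complex.ofReal_inj, hc,
        ← mul_inv, Real.mul_self_sqrt hpos.le, inv_mul_cancel₀ hpos.ne']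
    rw [projMat_of_ne h, Matrix.mem_specialUnitaryGroup_iff, Matrix.mem_unitaryGroup_iff]
    refine ⟨?_, ?_⟩
    · rw [star_smul, Complex.star_def, Complex.conj_ofReal, smul_mul_smul_comm, self_mul_star_of_quat hq, smul_smul, hcc, one_smul]
    · rw [Matrix.det_smul, Fintype.card_fin, pow_two, hcc]


/-- `adj` respects subtraction on `2 × 2` matrices. [folklore] -/
theorem adjugate_sub_two (A B : Matrix (Fin 2) (Fin 2) ℂ) :
    Matrix.adjugate (A - B) = Matrix.adjugate A - Matrix.adjugate B := by
  rw [adjugate_fin_two_eq_trace_smul_sub, adjugate_fin_two_eq_trace_smul_sub, adjugate_fin_two_eq_trace_smul_sub,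
    Matrix.trace_sub, sub_smul]
  abel

/-- `‖(adj d)†‖ ≤ 3‖d‖` (`adj d = tr d · 1 − d`, `|tr d| ≤ 2‖d‖` by the entry bound lit ✓`SolovayKitaev.norm_apply_le_norm`). [folklore] -/
theorem norm_star_adjugate_le (d : Matrix (Fin 2) (Fin 2) ℂ) : ‖star (Matrix.adjugate d)‖ ≤ 3 * ‖d‖ := by
  rw [norm_star, adjugate_fin_two_eq_trace_smul_sub]
  have htr : ‖d.trace‖ ≤ 2 * ‖d‖ := by
    rw [Matrix.trace_fin_two]
    calc ‖d 0 0 + d 1 1‖ ≤ ‖d 0 0‖ + ‖d 1 1‖ := norm_add_le _ _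
      _ ≤ ‖d‖ + ‖d‖ := add_le_add (Literature.Computability.QuantumComplexity.SolovayKitaev.norm_apply_le_norm d 0 0)
          (Literature.Computability.QuantumComplexity.SolovayKitaev.norm_apply_le_norm d 1 1)
      _ = 2 * ‖d‖ := by ring
  calc ‖d.trace • (1 : Matrix (Fin 2) (Fin 2) ℂ) - d‖ ≤ ‖d.trace • (1 : Matrix (Fin 2) (Fin 2) ℂ)‖ + ‖d‖ := norm_sub_le _ _
    _ = ‖d.trace‖ + ‖d‖ := by rw [norm_smul, CStarRing.norm_one, mul_one]
    _ ≤ 2 * ‖d‖ + ‖d‖ := by linarith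
    _ = 3 * ‖d‖ := by ring

/-- `‖½(d + (adj d)†)‖ ≤ 2‖d‖`: the quaternionic part is bounded. [folklore] -/
theorem norm_half_add_star_adjugate_le (d : Matrix (Fin 2) (Fin 2) ℂ) :
    ‖(2⁻¹ : ℂ) • (d + star (Matrix.adjugate d))‖ ≤ 2 * ‖d‖ := by
  have h2 : ‖(2⁻¹ : ℂ)‖ = 2⁻¹ := by simp
  rw [norm_smul, h2]
  have h3 := norm_star_adjugate_le d
  have h4 := norm_add_le d (star (Matrix.adjugate d))
  nlinarith [norm_nonneg d]

/-- ★ **THE SITE ESTIMATE.**  For `s ∈ SU(2)` and ANY `c ∈ M₂(ℂ)`, the normalised quaternionic part `k := projMat (½(c + (adj c)†)) ∈ SU(2)` of `c` satisfies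
`‖s − k‖ ≤ 4·‖s − c‖`.  Proof: `½(c + (adj c)†) = s·(1 + e)` with `e := ½(d + (adj d)†)`, `d := s†(c − s)`, `‖e‖ ≤ 2‖d‖ = 2‖s − c‖`; off the exceptional set
`projMat (s(1+e)) = s·‖1+e‖⁻¹(1+e)` (lit ✓`SU2Mean.projMat_mul_mul`; `‖1+e‖² = Re det (1+e)`) and `‖1 − ‖p‖⁻¹p‖ ≤ ‖1 − p‖ + |‖p‖ − 1| ≤ 2‖1 − p‖`; on it `‖e‖ = 1`. [folklore] -/
theorem norm_coe_sub_projMat_le (s : Matrix.specialUnitaryGroup (Fin 2) ℂ) (c : Matrix (Fin 2) (Fin 2) ℂ) :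
    ‖(s : Matrix (Fin 2) (Fin 2) ℂ) - projMat ((2⁻¹ : ℂ) • (c + star (Matrix.adjugate c)))‖ ≤ 4 * ‖(s : Matrix (Fin 2) (Fin 2) ℂ) - c‖ := by
  set q : Matrix (Fin 2) (Fin 2) ℂ := (2⁻¹ : ℂ) • (c + star (Matrix.adjugate c)) with hq_def
  have hq : star q = Matrix.adjugate q := star_half_add_eq_adjugate c
  have hsU := Matrix.mem_specialUnitaryGroup_iff.1 s.2
  have hss : (s : Matrix (Fin 2) (Fin 2) ℂ) * star (s : Matrix (Fin 2) (Fin 2) ℂ) = 1 := Matrix.mem_unitaryGroup_iff.1 hsU.1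
  have hss' : star (s : Matrix (Fin 2) (Fin 2) ℂ) * (s : Matrix (Fin 2) (Fin 2) ℂ) = 1 := Matrix.mem_unitaryGroup_iff'.1 hsU.1
  have hstarU : star (s : Matrix (Fin 2) (Fin 2) ℂ) ∈ Matrix.unitaryGroup (Fin 2) ℂ := (s⁻¹).2.1
  -- `d := s†(c − s)`, `‖d‖ = ‖s − c‖`
  set d : Matrix (Fin 2) (Fin 2) ℂ := star (s : Matrix (Fin 2) (Fin 2) ℂ) * (c - (s : Matrix (Fin 2) (Fin 2) ℂ)) with hd_def
  have hnd : ‖d‖ = ‖(s : Matrix (Fin 2) (Fin 2) ℂ) - c‖ := by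
    rw [hd_def, CStarRing.norm_mem_unitary_mul _ hstarU, norm_sub_rev]
  -- `e := ½(d + (adj d)†)`
  set e : Matrix (Fin 2) (Fin 2) ℂ := (2⁻¹ : ℂ) • (d + star (Matrix.adjugate d)) with he_def
  have hne : ‖e‖ ≤ 2 * ‖(s : Matrix (Fin 2) (Fin 2) ℂ) - c‖ := hnd ▸ norm_half_add_star_adjugate_le d
  -- `q = s (1 + e)`
  have hsd : (s : Matrix (Fin 2) (Fin 2) ℂ) * d = c - (s : Matrix (Fin 2) (Fin 2) ℂ) := by rw [hd_def, ← mul_assoc, hss, one_mul]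
  have hsθd : (s : Matrix (Fin 2) (Fin 2) ℂ) * star (Matrix.adjugate d) = star (Matrix.adjugate c) - (s : Matrix (Fin 2) (Fin 2) ℂ) := by
    calc (s : Matrix (Fin 2) (Fin 2) ℂ) * star (Matrix.adjugate d)
        = star (Matrix.adjugate (s : Matrix (Fin 2) (Fin 2) ℂ)) * star (Matrix.adjugate d) := by rw [star_adjugate_coe]
      _ = star (Matrix.adjugate ((s : Matrix (Fin 2) (Fin 2) ℂ) * d)) := (star_adjugate_mul _ _).symm
      _ = star (Matrix.adjugate (c - (s : Matrix (Fin 2) (Fin 2) ℂ))) := by rw [hsd]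
      _ = star (Matrix.adjugate c) - (s : Matrix (Fin 2) (Fin 2) ℂ) := by rw [adjugate_sub_two, star_sub, star_adjugate_coe]
  have hqp : q = (s : Matrix (Fin 2) (Fin 2) ℂ) * (1 + e) := by
    rw [hq_def, he_def, mul_add, mul_one, Matrix.mul_smul, mul_add, hsd, hsθd]
    module
  by_cases h0 : q.det = 0
  · -- exceptional branch: `q = 0`, `e = −1`, `‖e‖ = 1 ≤ 2‖s − c‖`, `k = 1`
    have hq0 : q = 0 := eq_zero_of_quat_of_det_eq_zero hq h0
    have he1 : e = -1 := by
      have h1 : (s : Matrix (Fin 2) (Fin 2) ℂ) * (1 + e) = 0 := by rw [← hqp, hq0]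
      have h2 : (1 : Matrix (Fin 2) (Fin 2) ℂ) + e = 0 := by
        have := congrArg (fun m => star (s : Matrix (Fin 2) (Fin 2) ℂ) * m) h1
        simpa only [← mul_assoc, hss', one_mul, mul_zero] using this
      exact eq_neg_of_add_eq_zero_right h2
    have h1e : (1 : ℝ) ≤ 2 * ‖(s : Matrix (Fin 2) (Fin 2) ℂ) - c‖ := by
      have : ‖e‖ = 1 := by rw [he1, norm_neg, CStarRing.norm_one]
      linarith
    rw [projMat_of_eq h0]
    calc ‖(s : Matrix (Fin 2) (Fin 2) ℂ) - 1‖ ≤ ‖(s : Matrix (Fin 2) (Fin 2) ℂ)‖ + ‖(1 : Matrix (Fin 2) (Fin 2) ℂ)‖ := norm_sub_le _ _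
      _ = 2 := by rw [CStarRing.norm_of_mem_unitary hsU.1, CStarRing.norm_one]; norm_num
      _ ≤ 4 * ‖(s : Matrix (Fin 2) (Fin 2) ℂ) - c‖ := by linarith
  · -- good branch
    have hp : star ((1 : Matrix (Fin 2) (Fin 2) ℂ) + e) = Matrix.adjugate (1 + e) := by
      rw [star_add, star_one, adjugate_add_two, Matrix.adjugate_one, he_def, star_half_add_eq_adjugate d]
    have hdetp : ((1 : Matrix (Fin 2) (Fin 2) ℂ) + e).det = q.det := by rw [hqp, Matrix.det_mul, hsU.2, one_mul]
    have hdetp0 : ((1 : Matrix (Fin 2) (Fin 2) ℂ) + e).det ≠ 0 := by rwa [hdetp]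
    have hproj : projMat q = (s : Matrix (Fin 2) (Fin 2) ℂ) * projMat (1 + e) := by
      rw [hqp, ← mul_one ((s : Matrix (Fin 2) (Fin 2) ℂ) * (1 + e)), projMat_mul_mul hsU.2 Matrix.det_one hdetp0, mul_one]
    set r : ℝ := Real.sqrt ((1 : Matrix (Fin 2) (Fin 2) ℂ) + e).det.re with hr
    have hnp : ‖(1 : Matrix (Fin 2) (Fin 2) ℂ) + e‖ = r := norm_eq_sqrt_det_re_of_quat hp
    have hr0 : 0 < r := by
      have hpos : 0 < ((1 : Matrix (Fin 2) (Fin 2) ℂ) + e).det.re := by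
        rcases (det_re_nonneg_of_quat hp).lt_or_eq with hlt | heq
        · exact hlt
        · exact absurd (by rw [det_eq_ofReal_of_quat hp, ← heq, Complex.ofReal_zero]) hdetp0
      rw [hr]; exact Real.sqrt_pos.2 hpos
    rw [hproj, projMat_of_ne hdetp0, ← hr]
    have h1 : (s : Matrix (Fin 2) (Fin 2) ℂ) - (s : Matrix (Fin 2) (Fin 2) ℂ) * (((r⁻¹ : ℝ) : ℂ) • (1 + e)) =
        (s : Matrix (Fin 2) (Fin 2) ℂ) * (1 - ((r⁻¹ : ℝ) : ℂ) • (1 + e)) := by rw [mul_sub, mul_one]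
    rw [h1, CStarRing.norm_mem_unitary_mul _ hsU.1]
    have h2 : ((1 : Matrix (Fin 2) (Fin 2) ℂ) + e) - ((r⁻¹ : ℝ) : ℂ) • ((1 : Matrix (Fin 2) (Fin 2) ℂ) + e) =
        ((1 - r⁻¹ : ℝ) : ℂ) • ((1 : Matrix (Fin 2) (Fin 2) ℂ) + e) := by
      rw [Complex.ofReal_sub, Complex.ofReal_one, sub_smul, one_smul]
    have h3 : |1 - r⁻¹| * r = |r - 1| := by
      rw [← abs_of_pos hr0, ← abs_mul, abs_of_pos hr0, sub_mul, one_mul, inv_mul_cancel₀ hr0.ne']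
    have h4 : |r - 1| ≤ ‖((1 : Matrix (Fin 2) (Fin 2) ℂ) + e) - 1‖ := by
      rw [← hnp, ← CStarRing.norm_one (E := Matrix (Fin 2) (Fin 2) ℂ)]
      exact abs_norm_sub_norm_le _ _
    have h5 : ‖((1 - r⁻¹ : ℝ) : ℂ) • ((1 : Matrix (Fin 2) (Fin 2) ℂ) + e)‖ = |1 - r⁻¹| * r := by
      rw [norm_smul, Complex.norm_real, Real.norm_eq_abs, hnp]
    calc ‖(1 : Matrix (Fin 2) (Fin 2) ℂ) - ((r⁻¹ : ℝ) : ℂ) • (1 + e)‖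
        ≤ ‖(1 : Matrix (Fin 2) (Fin 2) ℂ) - (1 + e)‖ + ‖((1 : Matrix (Fin 2) (Fin 2) ℂ) + e) - ((r⁻¹ : ℝ) : ℂ) • (1 + e)‖ :=
          norm_sub_le_norm_sub_add_norm_sub _ _ _
      _ = ‖e‖ + |1 - r⁻¹| * r := by
          rw [sub_add_cancel_left, norm_neg, h2, h5]
      _ = ‖e‖ + |r - 1| := by rw [h3]
      _ ≤ ‖e‖ + ‖((1 : Matrix (Fin 2) (Fin 2) ℂ) + e) - 1‖ := by linarith
      _ = 2 * ‖e‖ := by rw [add_sub_cancel_left]; ring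
      _ ≤ 4 * ‖(s : Matrix (Fin 2) (Fin 2) ℂ) - c‖ := by linarith


end Summit.QuantumFields.YangMills.Theorems.FluctuationComparisonRegPrIntLS2BetaQuaternionicPart

end
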